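import Summits.AtomisticToContinuum.HydrodynamicLimit.Theorems.RelayRaceLocalityNearConstantShortTimeHLMeansPinDefs
import Summits.AtomisticToContinuum.HydrodynamicLimit.Theorems.RelayRaceLocalityNearConstantShortTimeHLGeneralGibbs
import Summits.AtomisticToContinuum.HydrodynamicLimit.Theorems.RelayRaceLocalityNearConstantShortTimeHLGeneralFamilyFreeEnergyThermo
import Summits.AtomisticToContinuum.HydrodynamicLimit.Theorems.RelayRaceLocalityNearConstantShortTimeHLGeneralFamilyMeanDensity
import Summits.AtomisticToContinuum.HydrodynamicLimit.Theorems.ImplosionDichotomyHsEosLowDensity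
import Summits.AtomisticToContinuum.HydrodynamicLimit.Theorems.JaynesSqueezeHardSphereLDAFreeEnergyContinuous
import HarnessLib

/-!
# Crux `NearConstantShortTimeHL` (stmt-AtomisticToContinuum-12502), line `means-pin-entropy` — stub `stub_ldaGeneralFamilies`

Support file for the crux `…Theses.RelayRaceLocality.NearConstantShortTimeHL`, line `means-pin-entropy`: the
registered stub `stub_ldaGeneralFamilies : GeneralFamilyLDA` (S1, the LOCAL DENSITY APPROXIMATION of the canonical
dilute hard-sphere gas for GENERAL diameter/number families `(ε_N, n_N)`, `ε_N → 0`, `n_N ε_N³ → σ³`): (i) the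
pressure per particle `n_N⁻¹ log Z_N → ∫ ρ₁ · ρ₁σ³ f_ex′(ρ₁σ³)` at the thermodynamic activity
`a₁ = ρ₁ e^{g_σ(ρ₁)}`; (ii) the static mean of the log-profile `Λ₁ = log ρ₁ + g_σ(ρ₁) − 3/2 log(2πθ₁) − ‖v − u₁‖²/(2θ₁)`
under the canonical law `Q_N` tends to `∫ ρ₁ (log ρ₁ + g_σ(ρ₁) − 3/2 log(2πθ₁) − 3/2)`.

Assembly (`generalFamilyLDA_of_conjunct`, then `stub_ldaGeneralFamilies`):
* the low-density equation of state `hsEosLowDensity_proof` (`f_ex = F` analytic on `[0, η₀)`);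
* (i) = the diameter sandwich at thermodynamic activities (`tendsto_log_posPartition_thermoActivity`,
  files `…GeneralFamilyFreeEnergy[Thermo]`) fed with the CONJUNCT-family local density approximation for continuous
  densities (item 13459, `HardSphereLDA`), and `canonicalPartition = posPartition`
  (`BlockGibbsLine.canonicalPartition_eq_posPartition'`);
* (ii) = `E_Q[∫Λ₁ d emp] = E_{a₁}[n⁻¹∑A(xᵢ)] − 3/2` with `A = log ρ₁ + g_σ(ρ₁) − 3/2 log(2πθ₁)`
  (`integral_logProfileMean_canonicalLaw`, file `…GeneralGibbs`: Gaussian velocities given the positions), and the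
  mean empirical density `E_{a₁}[n⁻¹∑A(xᵢ)] → ∫ A ρ₁` from the general-family free energies by convexity
  (`tendsto_gibbsMean_of_freeEnergy`, file `…GeneralFamilyMeanDensity`).

References: E. Pulvirenti – D. Tsagkarogiannis, Comm. Math. Phys. 316 (2012) Thm 2.1; H. Spohn (1991) Part I §2.3.
-/

noncomputable section

namespace Summit.AtomisticToContinuum.HydrodynamicLimit.Theorems.NearConstantShortTimeHL

open scoped BigOperators ENNReal Topology
open MeasureTheory Set Filter
open Literature.MathematicalPhysics.KineticTheory Literature.Analysis.FluidPDE Literature.Analysis.FunctionSpaces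
open Summit.AtomisticToContinuum.HydrodynamicLimit.Theorems.HardSphereLDA
open Summit.AtomisticToContinuum.HydrodynamicLimit.Theorems.BlockGibbsLine
open Summit.AtomisticToContinuum.HydrodynamicLimit.Theorems.KineticWindowGronwallActivityInversion

/-! ## Small tools -/

/-- A unit-mass continuous density bounded by `η₁/σ³` forces `σ³ ≤ η₁`. [folklore] -/
theorem pow_three_le_of_packing {σ η₁ : ℝ} (hσ : 0 < σ) {ρ : T3 → ℝ} (hρc : Continuous ρ)
    (hpack : ∀ x, ρ x * σ ^ 3 ≤ η₁) (hρ1 : (∫ x, ρ x) = 1) : σ ^ 3 ≤ η₁ := by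
  obtain ⟨x, hx⟩ := exists_one_le_of_integral_eq_one' (integrable_of_continuous_T3 hρc) hρ1
  calc σ ^ 3 = 1 * σ ^ 3 := (one_mul _).symm
    _ ≤ ρ x * σ ^ 3 := mul_le_mul_of_nonneg_right hx (pow_pos hσ 3).le
    _ ≤ η₁ := hpack x

/-- `σ³ ≤ 1/64` gives `σ ≤ 1/4`. [folklore] -/
theorem le_quarter_of_pow_three_le {σ : ℝ} (h : σ ^ 3 ≤ 1 / 64) : σ ≤ 1 / 4 :=
  le_of_pow_le_pow_left₀ (by norm_num : (3 : ℕ) ≠ 0) (by norm_num) (h.trans (by norm_num))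

/-- Along an admissible family with `σ ≤ 1/4`, eventually `n_N ≥ 1` and the free volume `Z(1, ε_N, n_N)` is positive
(the general system is eventually LESS packed than the conjunct system at `5σ/4 ≤ 1/2`). [folklore] -/
theorem eventually_one_le_and_posPartition_one_pos {σ : ℝ} (hσ : 0 < σ) (hσ4 : σ ≤ 1 / 4) {ε : ℕ → ℝ} {n : ℕ → ℕ}
    (hε : ∀ N, 0 < ε N) (hε0 : Tendsto ε atTop (𝓝 0))
    (hn : Tendsto (fun N => (n N : ℝ) * ε N ^ 3) atTop (𝓝 (σ ^ 3))) :
    ∀ᶠ N in atTop, 1 ≤ n N ∧ 0 < posPartition (fun _ => (1 : ℝ)) (ε N) (n N) := by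
  filter_upwards [eventually_hsDiameter_le_le hσ hε hε0 hn (σm := σ / 2) (σp := 5 * σ / 4) (by positivity)
    (by linarith) (by linarith)] with N hN
  obtain ⟨hn1, -, hhi⟩ := hN
  refine ⟨hn1, ?_⟩
  have h1 : 0 < posPartition (fun _ => (1 : ℝ)) (hsDiameter (5 * σ / 4) (n N - 1)) (n N - 1 + 1) :=
    posPartition_pos continuous_const (fun _ => one_pos) (by linarith) _
  rw [Nat.sub_add_cancel hn1] at h1
  exact h1.trans_le (posPartition_antitone_diam measurable_const (fun _ => zero_le_one) (fun _ => le_rfl) hhi _)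

/-! ## The assembly from the conjunct-family local density approximation -/

/-- **GENERAL-FAMILY LDA FROM THE CONJUNCT-FAMILY LDA.** If along the conjunct family `(hsDiameter σ N, N+1)` the
free energy per particle at the thermodynamic activity of every continuous positive unit-mass density `ρ` with
`ρσ³ ≤ η_A` converges to `∫ ρ · ρσ³f_ex′(ρσ³)` (item 13459 (B1), continuous densities), then `GeneralFamilyLDA`
holds in its unfolded form. [cite: PulvirentiTsagkarogiannis2012, Thm 2.1] -/
theorem generalFamilyLDA_of_conjunct {ηA : ℝ} (hηA : 0 < ηA)
    (hB1c : ∀ σ : ℝ, 0 < σ → ∀ ρ : T3 → ℝ, Continuous ρ → (∀ x, 0 < ρ x) → (∫ x, ρ x) = 1 →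
      (∀ x, ρ x * σ ^ 3 ≤ ηA) →
      Tendsto (fun N : ℕ => (((N + 1 : ℕ) : ℝ))⁻¹ *
        Real.log (posPartition (thermoActivity σ ρ) (hsDiameter σ N) (N + 1))) atTop
        (𝓝 (∫ x, ρ x * (ρ x * σ ^ 3 * deriv hsExcessFreeEnergy (ρ x * σ ^ 3))))) :
    ∃ η₁ : ℝ, 0 < η₁ ∧ ∀ σ : ℝ, 0 < σ →
    ∀ c : ℝ, 0 < c → ∀ ρ₁ : T3 → ℝ, Continuous ρ₁ → (∀ x, c ≤ ρ₁ x ∧ ρ₁ x * σ ^ 3 ≤ η₁) → ∫ x, ρ₁ x = 1 →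
    ∀ (u₁ : T3 → V3) (θ₁ : T3 → ℝ), Continuous u₁ → Continuous θ₁ → (∀ x, 0 < θ₁ x) →
    ∀ (ε : ℕ → ℝ) (n : ℕ → ℕ), (∀ N, 0 < ε N) → Tendsto ε atTop (𝓝 0) →
    Tendsto (fun N => (n N : ℝ) * ε N ^ 3) atTop (𝓝 (σ ^ 3)) →
    Tendsto (fun N => (n N : ℝ)⁻¹ *
        Real.log (canonicalPartition (Torus.geometry (Fin 3)) (ε N) (n N)
          (localGibbsProfile (thermoActivity σ ρ₁) u₁ θ₁))) atTop
      (𝓝 (∫ x, ρ₁ x * (ρ₁ x * σ ^ 3 * deriv hsExcessFreeEnergy (ρ₁ x * σ ^ 3)))) ∧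
    (∀ᶠ N in atTop, Integrable (fun z : Config (n N) (Fin 3) T3 => ∫ y,
        (Real.log (ρ₁ y.1) + (hsExcessFreeEnergy (ρ₁ y.1 * σ ^ 3) +
          ρ₁ y.1 * σ ^ 3 * deriv hsExcessFreeEnergy (ρ₁ y.1 * σ ^ 3)) -
          3 / 2 * Real.log (2 * Real.pi * θ₁ y.1) - ‖y.2 - u₁ y.1‖ ^ 2 / (2 * θ₁ y.1)) ∂(empiricalMeasure z))
      ((liouville (Torus.geometry (Fin 3)) (n N) (ε N)).withDensity fun z =>
        ENNReal.ofReal (canonicalDensity (Torus.geometry (Fin 3)) (ε N) (n N)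
          (localGibbsProfile (thermoActivity σ ρ₁) u₁ θ₁) z))) ∧
    Tendsto (fun N => ∫ z, (∫ y,
        (Real.log (ρ₁ y.1) + (hsExcessFreeEnergy (ρ₁ y.1 * σ ^ 3) +
          ρ₁ y.1 * σ ^ 3 * deriv hsExcessFreeEnergy (ρ₁ y.1 * σ ^ 3)) -
          3 / 2 * Real.log (2 * Real.pi * θ₁ y.1) - ‖y.2 - u₁ y.1‖ ^ 2 / (2 * θ₁ y.1)) ∂(empiricalMeasure z))
      ∂((liouville (Torus.geometry (Fin 3)) (n N) (ε N)).withDensity fun z =>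
        ENNReal.ofReal (canonicalDensity (Torus.geometry (Fin 3)) (ε N) (n N)
          (localGibbsProfile (thermoActivity σ ρ₁) u₁ θ₁) z))) atTop
      (𝓝 (∫ x, ρ₁ x * (Real.log (ρ₁ x) + (hsExcessFreeEnergy (ρ₁ x * σ ^ 3) +
          ρ₁ x * σ ^ 3 * deriv hsExcessFreeEnergy (ρ₁ x * σ ^ 3)) -
          3 / 2 * Real.log (2 * Real.pi * θ₁ x) - 3 / 2))) := by
  -- the equation of state and the two thresholds of the general-family tools
  obtain ⟨η₀, hη₀, F, hF, hEq, -, -, -⟩ := hsEosLowDensity_proof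
  obtain ⟨ηB, hηB, hMD⟩ := tendsto_gibbsMean_of_freeEnergy hη₀ hF hEq
  refine ⟨min (min (η₀ / 6) (ηA / 3)) (min ηB (1 / 64)), lt_min (lt_min (by positivity) (by positivity))
    (lt_min hηB (by norm_num)), ?_⟩
  intro σ hσ c hc ρ₁ hρ₁c hρ₁ hρ₁1 u₁ θ₁ hu hθ hθ0 ε n hε hε0 hn
  set η₁ := min (min (η₀ / 6) (ηA / 3)) (min ηB (1 / 64)) with hη₁
  have hη₁0 : η₁ ≤ η₀ / 6 := (min_le_left _ _).trans (min_le_left _ _)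
  have hη₁A : η₁ ≤ ηA / 3 := (min_le_left _ _).trans (min_le_right _ _)
  have hη₁B : η₁ ≤ ηB := (min_le_right _ _).trans (min_le_left _ _)
  have hη₁64 : η₁ ≤ 1 / 64 := (min_le_right _ _).trans (min_le_right _ _)
  have hσ3 : 0 < σ ^ 3 := pow_pos hσ 3
  -- the band of `ρ₁`
  set R : ℝ := η₁ / σ ^ 3 with hR
  have hcρ : ∀ x, c ≤ ρ₁ x := fun x => (hρ₁ x).1
  have hρR : ∀ x, ρ₁ x ≤ R := fun x => by rw [hR, le_div_iff₀ hσ3]; exact (hρ₁ x).2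
  have hRσ : R * σ ^ 3 = η₁ := by rw [hR, div_mul_cancel₀ _ hσ3.ne']
  have hcR : c ≤ R := (hcρ 0).trans (hρR 0)
  have hρ₁pos : ∀ x, 0 < ρ₁ x := fun x => hc.trans_le (hcρ x)
  have hσ3le : σ ^ 3 ≤ η₁ := pow_three_le_of_packing hσ hρ₁c (fun x => (hρ₁ x).2) hρ₁1
  have hσ4 : σ ≤ 1 / 4 := le_quarter_of_pow_three_le (hσ3le.trans hη₁64)
  have hσ2 : σ < 1 / 2 := by linarith
  have h4R : 4 * R * σ ^ 3 ≤ η₀ := by nlinarith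
  -- the conjunct limits at nearby `σ'`, for densities of the enlarged band
  have hconj : ∀ ρ : T3 → ℝ, Continuous ρ → (∀ x, c / 2 ≤ ρ x ∧ ρ x ≤ R + c / 2) → (∫ x, ρ x) = 1 →
      ∀ σ' : ℝ, |σ' - σ| < σ / 4 → Tendsto (fun N : ℕ => (((N + 1 : ℕ) : ℝ))⁻¹ *
        Real.log (posPartition (thermoActivity σ' ρ) (hsDiameter σ' N) (N + 1))) atTop
        (𝓝 (∫ x, ρ x * (ρ x * σ' ^ 3 * deriv hsExcessFreeEnergy (ρ x * σ' ^ 3)))) := by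
    intro ρ hρc hρb hρ1 σ' hσ'
    obtain ⟨hσ'0, -, hcube⟩ := cube_window hσ hσ'.le
    refine hB1c σ' hσ'0 ρ hρc (fun x => lt_of_lt_of_le (by positivity) (hρb x).1) hρ1 fun x => ?_
    have hρ0 : 0 ≤ ρ x := le_trans (by positivity) (hρb x).1
    calc ρ x * σ' ^ 3 ≤ (R + c / 2) * (2 * σ ^ 3) := mul_le_mul (hρb x).2 hcube (pow_nonneg hσ'0.le 3) (by positivity)
      _ ≤ 3 * (R * σ ^ 3) := by nlinarith
      _ ≤ ηA := by rw [hRσ]; linarith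
  -- general-family free energies for all densities of the enlarged band (the diameter sandwich)
  have hgenB1 : ∀ ρ : T3 → ℝ, Continuous ρ → (∀ x, c / 2 ≤ ρ x ∧ ρ x ≤ R + c / 2) → (∫ x, ρ x) = 1 →
      Tendsto (fun N => (n N : ℝ)⁻¹ * Real.log (posPartition (thermoActivity σ ρ) (ε N) (n N))) atTop
        (𝓝 (∫ x, ρ x * (ρ x * σ ^ 3 * deriv hsExcessFreeEnergy (ρ x * σ ^ 3)))) := by
    intro ρ hρc hρb hρ1
    refine tendsto_log_posPartition_thermoActivity hF hEq hσ hσ2 hρc (c := c / 2) (R := R + c / 2) (by positivity)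
      (fun x => (hρb x).1) (fun x => (hρb x).2) (by nlinarith) hε hε0 hn (δ := σ / 4) (by positivity)
      (hconj ρ hρc hρb hρ1)
  have hρ₁b : ∀ x, c / 2 ≤ ρ₁ x ∧ ρ₁ x ≤ R + c / 2 := fun x => ⟨by linarith [hcρ x], by linarith [hρR x]⟩
  -- the activity `a₁ = α_σ(ρ₁)`: continuity and bounds
  have hw0 : |σ - σ| ≤ σ / 4 := by rw [sub_self, abs_zero]; positivity
  have ha_c : Continuous (thermoActivity σ ρ₁) := continuous_thermoActivity_of_near hF hEq hσ hw0 hρ₁c hc hcρ hρR h4R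
  have ha_pos : ∀ x, 0 < thermoActivity σ ρ₁ x := fun x => by
    rw [thermoActivity]; exact mul_pos (hρ₁pos x) (Real.exp_pos _)
  obtain ⟨Aa, -, hAa⟩ := exists_forall_abs_le_of_continuous ha_c
  have hAa' : ∀ x, thermoActivity σ ρ₁ x ≤ Aa := fun x => (le_abs_self _).trans (hAa x)
  have hloga_c : Continuous fun x => Real.log (thermoActivity σ ρ₁ x) := ha_c.log fun x => (ha_pos x).ne'
  obtain ⟨Ba, -, hBa⟩ := exists_forall_abs_le_of_continuous hloga_c
  have ha_lo : ∀ x, Real.exp (-Ba) ≤ thermoActivity σ ρ₁ x := fun x => by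
    rw [← Real.exp_log (ha_pos x)]; exact Real.exp_le_exp.2 (abs_le.1 (hBa x)).1
  -- the one-body position observable `A = log ρ₁ + g_σ(ρ₁) − 3/2 log(2πθ₁) = log a₁ − 3/2 log(2πθ₁)`
  set A : T3 → ℝ := fun x => Real.log (ρ₁ x) + (hsExcessFreeEnergy (ρ₁ x * σ ^ 3) +
    ρ₁ x * σ ^ 3 * deriv hsExcessFreeEnergy (ρ₁ x * σ ^ 3)) - 3 / 2 * Real.log (2 * Real.pi * θ₁ x) with hA
  have hA_eq : A = fun x => Real.log (thermoActivity σ ρ₁ x) - 3 / 2 * Real.log (2 * Real.pi * θ₁ x) := by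
    funext x
    simp only [hA]
    rw [thermoActivity, Real.log_mul (hρ₁pos x).ne' (Real.exp_pos _).ne', Real.log_exp]
  have hA_c : Continuous A := by
    rw [hA_eq]
    exact hloga_c.sub (continuous_const.mul ((continuous_const.mul hθ).log fun x =>
      (mul_pos (mul_pos two_pos Real.pi_pos) (hθ0 x)).ne'))
  obtain ⟨K, -, hK⟩ := exists_forall_abs_le_of_continuous hA_c
  -- eventually: `n_N ≥ 1`, positive free volume, positive partition function; then the Gaussian bookkeeping
  have hev := eventually_one_le_and_posPartition_one_pos hσ hσ4 hε hε0 hn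
  have hGG : ∀ N, 1 ≤ n N → 0 < posPartition (fun _ => (1 : ℝ)) (ε N) (n N) →
      Integrable (fun z : Config (n N) (Fin 3) T3 =>
          ∫ y, (A y.1 - ‖y.2 - u₁ y.1‖ ^ 2 / (2 * θ₁ y.1)) ∂(empiricalMeasure z))
          ((liouville (Torus.geometry (Fin 3)) (n N) (ε N)).withDensity fun z =>
            ENNReal.ofReal (canonicalDensity (Torus.geometry (Fin 3)) (ε N) (n N)
              (localGibbsProfile (thermoActivity σ ρ₁) u₁ θ₁) z)) ∧
        ∫ z, (∫ y, (A y.1 - ‖y.2 - u₁ y.1‖ ^ 2 / (2 * θ₁ y.1)) ∂(empiricalMeasure z))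
            ∂((liouville (Torus.geometry (Fin 3)) (n N) (ε N)).withDensity fun z =>
              ENNReal.ofReal (canonicalDensity (Torus.geometry (Fin 3)) (ε N) (n N)
                (localGibbsProfile (thermoActivity σ ρ₁) u₁ θ₁) z)) =
          ((posPartition (thermoActivity σ ρ₁) (ε N) (n N))⁻¹ *
              ∫ x, posWeight (thermoActivity σ ρ₁) (ε N) (n N) x * (((n N : ℕ) : ℝ)⁻¹ * ∑ i, A (x i))) - 3 / 2 := by
    intro N hn1 hZ1
    have hZ : 0 < posPartition (thermoActivity σ ρ₁) (ε N) (n N) :=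
      posPartition_pos_of_le ha_c.measurable (Real.exp_pos _) ha_lo hAa' hZ1
    rw [liouville_withDensity_canonicalDensity]
    exact integral_logProfileMean_canonicalLaw ha_c.measurable hθ.measurable hu.measurable
      (fun x => (ha_pos x).le) hAa' hθ0 hn1 hZ hA_c.measurable hK
  refine ⟨?_, ?_, ?_⟩
  · -- (i) the pressure per particle
    have h1 := hgenB1 ρ₁ hρ₁c hρ₁b hρ₁1
    refine h1.congr fun N => ?_
    rw [canonicalPartition_eq_posPartition' ha_c.measurable hθ.measurable hu.measurable (fun x => (ha_pos x).le) hθ0]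
  · -- (ii a) integrability, eventually
    filter_upwards [hev] with N hN
    exact (hGG N hN.1 hN.2).1
  · -- (ii b) the static mean of the log-profile
    have hmean := hMD σ hσ c R hc ρ₁ hρ₁c (fun x => ⟨hcρ x, hρR x⟩) (by rw [hRσ]; exact hη₁B) hρ₁1 ε n hev
      hgenB1 A hA_c
    have hlim := hmean.sub_const (3 / 2)
    have htarget : (∫ x, A x * ρ₁ x) - 3 / 2 = ∫ x, ρ₁ x * (Real.log (ρ₁ x) +
        (hsExcessFreeEnergy (ρ₁ x * σ ^ 3) + ρ₁ x * σ ^ 3 * deriv hsExcessFreeEnergy (ρ₁ x * σ ^ 3)) -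
        3 / 2 * Real.log (2 * Real.pi * θ₁ x) - 3 / 2) := by
      have hi1 : Integrable fun x => A x * ρ₁ x := integrable_of_continuous_T3 (hA_c.mul hρ₁c)
      have hi2 : Integrable fun x => (3 / 2 : ℝ) * ρ₁ x := (integrable_of_continuous_T3 hρ₁c).const_mul _
      have e1 : (fun x => ρ₁ x * (Real.log (ρ₁ x) +
          (hsExcessFreeEnergy (ρ₁ x * σ ^ 3) + ρ₁ x * σ ^ 3 * deriv hsExcessFreeEnergy (ρ₁ x * σ ^ 3)) -
          3 / 2 * Real.log (2 * Real.pi * θ₁ x) - 3 / 2)) = fun x => A x * ρ₁ x - 3 / 2 * ρ₁ x := by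
        funext x; simp only [hA]; ring
      rw [e1, integral_sub hi1 hi2, integral_const_mul, hρ₁1, mul_one]
    rw [← htarget]
    refine hlim.congr' ?_
    filter_upwards [hev] with N hN
    exact (hGG N hN.1 hN.2).2.symm

/-! ## The registered stub -/

/-- **S1 — `stub_ldaGeneralFamilies : GeneralFamilyLDA`** (registered stub of crux stmt-AtomisticToContinuum-12502, line
`means-pin-entropy`): the local density approximation of the canonical dilute hard-sphere gas for GENERAL
diameter/number families — (i) pressure per particle, (ii) static mean of the log-profile. The conjunct-family input
(item 13459 (B1), continuous densities) is `HardSphereLDA.tendsto_freeEnergy_continuous`, fed with the low-density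
equation of state `hsEosLowDensity_proof` and the insertion-factor package `insertionFactor_package`; everything
else is `generalFamilyLDA_of_conjunct`. [cite: PulvirentiTsagkarogiannis2012, Thm 2.1] -/
theorem stub_ldaGeneralFamilies : GeneralFamilyLDA := by
  obtain ⟨η₀, hη₀, F, hF, hEq, -, -, hfree⟩ := hsEosLowDensity_proof
  obtain ⟨r, hr, Rf, hsol, hbd, hcont, huniq, η₂, hη₂, -, hexp⟩ := insertionFactor_package
  obtain ⟨ηs, hηs, hB1⟩ := tendsto_freeEnergy_continuous hη₀ hF hEq hfree hr hsol hbd hcont huniq hη₂ hexp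
  exact generalFamilyLDA_of_conjunct hηs hB1

end Summit.AtomisticToContinuum.HydrodynamicLimit.Theorems.NearConstantShortTimeHL

end
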